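import Literature.Probability.RandomMatrix.WeylIntegrationFormula
import Literature.RepresentationTheory.CompactGroups.WeylIntegrationUnitary
import HarnessLib

/-!
# Weyl's integration formula on `U(N)` (eigenvalue-density form) HOLDS

statement-level skeleton of published theorems with citation tags; proofs where landed; nothing here is a claim
about the Yang–Mills mass gap

Discharge of the named fact `Literature.Probability.RandomMatrix.WeylIntegrationFormulaUN`
(`Literature/Probability/RandomMatrix/WeylIntegrationFormula.lean`: Meckes 2019 Thm 3.1 / Procesi 2007 (9.1.1), the
eigenangle form `∫_{U(N)} g dHaar = (N!(2π)^N)⁻¹ ∫_{[−π,π]^N} ∏_{j<k}|e^{iθ_j} − e^{iθ_k}|² g(diag e^{iθ}) dθ` for measurable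
class functions `g ≥ 0`) from the tree's PROVED class-function form of Bröcker–tom Dieck IV (1.11) for `U(n)`,
`Literature.RepresentationTheory.CompactGroups.WeylIntegration.lintegral_unitaryGroup_eq_angleIntegral`
(`∫_{U(n)} F = ((2π)ⁿ n!)⁻¹ · I(F)`, `I(F) = ∫_{(−π,π]ⁿ} F(diag e^{iθ}) ∏_{j≺k}|e^{iθ_j} − e^{iθ_k}|² dθ`; unit
`lit-balaban-p28`).  The two statements differ only cosmetically: the box `(−π,π]^N` versus `[−π,π]^N` (a Lebesgue-null
face), the enumeration of the unordered pairs in the Vandermonde weight (`j ≺ k` for the tree's fixed enumeration versus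
`j < k` in `Fin N`; the weight is a symmetric function of the pair), the order of the two factors of the integrand, and
the spelling of the constant `((2π)^N N!)⁻¹` in `ℝ≥0∞`.

Consequence: the conditional consumers of the fact (the spectral window law
`Summits/QuantumFields/YangMills/Theorems/EguchiKawaiDirectionLadderSpectralWindowLaw.lean` and its descendants) become
unconditional by applying them to `weylIntegrationFormulaUN_holds`.

## References
* E. S. Meckes, *The Random Matrix Theory of the Classical Compact Groups*, CUP 2019, Theorem 3.1 (p. 60). [Meckes2019]
* Th. Bröcker, T. tom Dieck, *Representations of Compact Lie Groups*, GTM 98 (1985), Ch. IV (1.11) p. 163. [BrockerTomDieck1985]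
-/

noncomputable section

open MeasureTheory Complex
open scoped ENNReal Real

namespace Literature.Probability.RandomMatrix

open Literature.MathematicalPhysics.QuantumFieldTheory (haarProbability)
open Literature.LinearAlgebra.Matrix (diagonalTorusHom diagonalTorus)
open Literature.RepresentationTheory.CompactGroups.WeylIntegration

/-- For a symmetric function of pairs on a finite linear order, the product over ordered off-diagonal pairs is the
square of the product over increasing pairs: `∏_i ∏_{j≠i} h i j = ∏_j ∏_{k>j} (h j k)²`. [folklore] -/
private theorem prod_univ_erase_eq_prod_Ioi_sq {N : ℕ} (h : Fin N → Fin N → ℝ) (hsym : ∀ j k, h j k = h k j) :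
    ∏ i, ∏ j ∈ Finset.univ.erase i, h i j = ∏ j, ∏ k ∈ Finset.Ioi j, h j k ^ 2 := by
  have hsplit : ∀ i : Fin N, Finset.univ.erase i = Finset.Iio i ∪ Finset.Ioi i := by
    intro i; ext j
    simp only [Finset.mem_erase, Finset.mem_univ, and_true, Finset.mem_union, Finset.mem_Iio, Finset.mem_Ioi]
    exact ⟨fun hne => lt_or_gt_of_ne hne, fun hlt => by rcases hlt with hlt | hlt <;> [exact hlt.ne; exact hlt.ne']⟩
  have hdisj : ∀ i : Fin N, Disjoint (Finset.Iio i) (Finset.Ioi i) := by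
    intro i
    rw [Finset.disjoint_left]
    intro j hj hj'
    exact lt_asymm (Finset.mem_Iio.1 hj) (Finset.mem_Ioi.1 hj')
  simp_rw [hsplit, Finset.prod_union (hdisj _), Finset.prod_mul_distrib]
  have hswap : ∏ i : Fin N, ∏ j ∈ Finset.Iio i, h i j = ∏ j : Fin N, ∏ i ∈ Finset.Ioi j, h i j :=
    Finset.prod_comm' (fun i j => by simp [Finset.mem_Iio, Finset.mem_Ioi])
  rw [hswap, ← Finset.prod_mul_distrib]
  refine Finset.prod_congr rfl fun j _ => ?_
  rw [← Finset.prod_mul_distrib]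
  refine Finset.prod_congr rfl fun k _ => ?_
  rw [hsym k j, sq]

/-- The Vandermonde weight of the fact (`∏_{j<k}` in the order of `Fin N`) equals the tree's weight over the
enumerated pairs `OD (Fin N)` (both are `(∏_i ∏_{j≠i} |e^{iθ_i} − e^{iθ_j}|)`, by symmetry of the pair function).
[folklore] -/
private theorem prod_Ioi_norm_exp_sub_sq_eq_prod_OD {N : ℕ} (θ : Fin N → ℝ) :
    ∏ j : Fin N, ∏ k ∈ Finset.Ioi j, ‖cexp (θ j * I) - cexp (θ k * I)‖ ^ 2 =
      ∏ p : OD (Fin N), ‖cexp (θ p.1.1 * I) - cexp (θ p.1.2 * I)‖ ^ 2 := by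
  rw [← prod_offDiag_norm_sub_torusPt θ,
    ← prod_univ_erase_eq_prod_Ioi_sq (fun j k => ‖cexp (θ j * I) - cexp (θ k * I)‖) (fun j k => norm_sub_rev _ _)]
  simp only [coe_torusPt, Matrix.diagonal_apply_eq]

/-- **Weyl's integration formula on `U(N)` in eigenangle form HOLDS** (discharge of the named fact
`WeylIntegrationFormulaUN`), from the tree's class-function form of Bröcker–tom Dieck IV (1.11)
(`WeylIntegration.lintegral_unitaryGroup_eq_angleIntegral`). [cite: Meckes2019, Theorem 3.1 (p. 60)]
[cite: BrockerTomDieck1985, IV (1.11) (p0163)] -/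
theorem weylIntegrationFormulaUN_holds : WeylIntegrationFormulaUN := by
  intro N g hg hcl
  rw [lintegral_unitaryGroup_eq_angleIntegral hg (fun V U => hcl U V)]
  -- the constant
  have hconst : ENNReal.ofReal (((2 * π) ^ N * (N.factorial : ℝ))⁻¹) =
      (ENNReal.ofReal (2 * π) ^ N * (N.factorial : ℝ≥0∞))⁻¹ := by
    rw [ENNReal.ofReal_inv_of_pos (by positivity), ENNReal.ofReal_mul (by positivity),
      ENNReal.ofReal_pow Real.two_pi_pos.le, ENNReal.ofReal_natCast]
  rw [hconst]
  simp only [Fintype.card_fin]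
  congr 1
  -- the angle integral: box `(−π,π]^N` versus `[−π,π]^N`, pair enumeration, order of factors
  unfold angleIntegral
  have hbox : (Set.pi Set.univ fun _ : Fin N => Set.Ioc (-π) π) =ᵐ[volume]
      (Set.pi Set.univ fun _ : Fin N => Set.Icc (-π) π) := by
    have h := Measure.univ_pi_Ioc_ae_eq_Icc (μ := fun _ : Fin N => (volume : Measure ℝ))
      (f := fun _ => -π) (g := fun _ => π)
    rw [← Set.pi_univ_Icc] at h
    exact h
  rw [setLIntegral_congr hbox]
  refine lintegral_congr fun θ => ?_
  rw [mul_comm, prod_Ioi_norm_exp_sub_sq_eq_prod_OD θ]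
  rfl

end Literature.Probability.RandomMatrix

end
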